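import Summits.NavierStokesRegularity.NavierStokesRegularity.Theorems.SoloSalvageMagsanop2026Enstrophy
import Literature.Analysis.FluidPDE.BKMClassGradientContinuity
import Summits.NavierStokesRegularity.NavierStokesRegularity.Theorems.EfficiencyFloorNearSaturationNearMaximiserSeqCoreTools
import HarnessLib

/-!
# Route `EfficiencyFloor`, crux `NearSaturationNearMaximiser` (stmt-NavierStokesRegularity-25482): the STRETCHING DIFFERENCE —
# a trilinear Hölder bound `|S(v) − S(w)| ≤ ‖ω−θ‖₄‖ω‖₄‖Dv‖₂ + ‖θ‖₄‖ω‖₄‖D(v−w)‖₂ + ‖θ‖₄‖ω−θ‖₄‖Dw‖₂`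

Helper file (`--supports stmt-NavierStokesRegularity-25482`), analytic half (part 1) of the sequential core of stmt-25482
(`…SeqCore`): the vortex stretching `S(v) = ∫⟪curl v, Dv·curl v⟫` is locally Lipschitz on the admissible class in the
`Ḣ¹ ∩ Ḣ²` sense. Ingredients: Cauchy–Schwarz in `L²` (§1), the trilinear bound `∫‖f‖‖g‖‖A‖ ≤ ‖f‖₄‖g‖₄‖A‖₂` (§2), the
pointwise expansion `⟪ω,Aω⟫ − ⟪θ,Bθ⟫ = ⟪ω−θ,Aω⟫ + ⟪θ,(A−B)ω⟫ + ⟪θ,B(ω−θ)⟫` (§3), the div–curl identity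
`∫|Dv|²_F = ∫|curl v|²` (tree: `integral_frobeniusNormSq_fderiv_eq_integral_norm_curl_sq`) giving `‖Dv‖₂² ≤ Z(v)` in operator
norm, and Ladyzhenskaya's inequality for the vorticity (tree: `Magsanop2026Enstrophy.integral_curl_pow_four_le`, from
Mathlib's Gagliardo–Nirenberg–Sobolev constant) in raw-integral form `∫‖curl v‖⁴ ≤ K³ √Z · Pal √Pal`.

HONEST FRAMING: inequalities for HYPOTHETICAL admissible fields; nothing about stmt-25482 or Navier–Stokes regularity is
decided; no summit statement is proved. [folklore]
-/

-- the problem directory repeats the summit name (`NavierStokesRegularity/NavierStokesRegularity`)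
set_option linter.dupNamespace false

noncomputable section

namespace Summit.NavierStokesRegularity.NavierStokesRegularity.Theorems

namespace NearSaturationNearMaximiser

namespace SeqCore

open Set MeasureTheory Filter Topology Function
open scoped InnerProductSpace ENNReal NNReal
open Literature.Analysis.FluidPDE
open Magsanop2026Enstrophy (K6_nonneg slice_integrable integral_curl_pow_four_le)
open RigidExit.ReferenceShadowing

/-! ## §1 Cauchy–Schwarz in `L²` for nonnegative continuous functions -/

/-- `∫ a·b ≤ √(∫a²)·√(∫b²)` for continuous `a, b ≥ 0` with `a², b² ∈ L¹` (Hölder `2,2`). [folklore] -/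
theorem integral_mul_le_sqrt {a b : EuclideanSpace ℝ (Fin 3) → ℝ} (ha : Continuous a) (hb : Continuous b)
    (ha0 : ∀ x, 0 ≤ a x) (hb0 : ∀ x, 0 ≤ b x) (ha2 : Integrable (fun x => a x ^ 2)) (hb2 : Integrable (fun x => b x ^ 2)) :
    ∫ x, a x * b x ≤ Real.sqrt (∫ x, a x ^ 2) * Real.sqrt (∫ x, b x ^ 2) := by
  have ma : MemLp a 2 volume :=
    (memLp_two_iff_integrable_sq_norm ha.aestronglyMeasurable).2
      (ha2.congr (ae_of_all _ fun x => by simp only [Real.norm_eq_abs, sq_abs]))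
  have mb : MemLp b 2 volume :=
    (memLp_two_iff_integrable_sq_norm hb.aestronglyMeasurable).2
      (hb2.congr (ae_of_all _ fun x => by simp only [Real.norm_eq_abs, sq_abs]))
  have hH := integral_mul_le_Lp_mul_Lq_of_nonneg (μ := (volume : Measure (EuclideanSpace ℝ (Fin 3))))
    Real.HolderConjugate.two_two (f := a) (g := b) (ae_of_all _ ha0) (ae_of_all _ hb0)
    (by rw [ENNReal.ofReal_ofNat]; exact ma) (by rw [ENNReal.ofReal_ofNat]; exact mb)
  have e1 : ∫ x, a x ^ (2 : ℝ) = ∫ x, a x ^ 2 := integral_congr_ae (ae_of_all _ fun x => by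
    show a x ^ (2 : ℝ) = a x ^ 2
    rw [Real.rpow_two])
  have e2 : ∫ x, b x ^ (2 : ℝ) = ∫ x, b x ^ 2 := integral_congr_ae (ae_of_all _ fun x => by
    show b x ^ (2 : ℝ) = b x ^ 2
    rw [Real.rpow_two])
  rw [e1, e2] at hH
  rwa [Real.sqrt_eq_rpow, Real.sqrt_eq_rpow]

/-- `∫ a²·b² ≤ √(∫a⁴)·√(∫b⁴)`, and `a²b² ∈ L¹`, for continuous `a, b ≥ 0` with `a⁴, b⁴ ∈ L¹`. [folklore] -/
theorem integral_sq_mul_sq_le {a b : EuclideanSpace ℝ (Fin 3) → ℝ} (ha : Continuous a) (hb : Continuous b)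
    (ha4 : Integrable (fun x => a x ^ 4)) (hb4 : Integrable (fun x => b x ^ 4)) :
    Integrable (fun x => (a x * b x) ^ 2) ∧
      ∫ x, (a x * b x) ^ 2 ≤ Real.sqrt (∫ x, a x ^ 4) * Real.sqrt (∫ x, b x ^ 4) := by
  have hI : Integrable (fun x => (a x * b x) ^ 2) := by
    refine ((ha4.add hb4).div_const 2).mono' ((ha.mul hb).pow 2).aestronglyMeasurable (ae_of_all _ fun x => ?_)
    rw [Real.norm_eq_abs, abs_of_nonneg (sq_nonneg _)]
    simp only [Pi.add_apply]
    nlinarith [sq_nonneg (a x ^ 2 - b x ^ 2)]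
  refine ⟨hI, ?_⟩
  have ha4' : Integrable (fun x => (a x ^ 2) ^ 2) := ha4.congr (ae_of_all _ fun x => by simp only; ring)
  have hb4' : Integrable (fun x => (b x ^ 2) ^ 2) := hb4.congr (ae_of_all _ fun x => by simp only; ring)
  have h := integral_mul_le_sqrt (a := fun x => a x ^ 2) (b := fun x => b x ^ 2) (ha.pow 2) (hb.pow 2)
    (fun x => sq_nonneg _) (fun x => sq_nonneg _) ha4' hb4'
  have e1 : ∫ x, (a x ^ 2) ^ 2 = ∫ x, a x ^ 4 := integral_congr_ae (ae_of_all _ fun x => by simp only; ring)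
  have e2 : ∫ x, (b x ^ 2) ^ 2 = ∫ x, b x ^ 4 := integral_congr_ae (ae_of_all _ fun x => by simp only; ring)
  have e3 : ∫ x, a x ^ 2 * b x ^ 2 = ∫ x, (a x * b x) ^ 2 := integral_congr_ae (ae_of_all _ fun x => by simp only; ring)
  rw [e1, e2, e3] at h
  exact h

/-! ## §2 The trilinear bound `|∫⟨f, A g⟩| ≤ ‖f‖_{L⁴} ‖g‖_{L⁴} ‖A‖_{L²}` -/

/-- **Trilinear Hölder bound**: for continuous `f, g : ℝ³ → ℝ³` with `‖f‖⁴, ‖g‖⁴ ∈ L¹` and a continuous operator field `A`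
with `‖A‖² ∈ L¹`: the integrand `‖f‖·‖g‖·‖A‖` is integrable and
`∫ ‖f‖‖g‖‖A‖ ≤ √(√(∫‖f‖⁴)·√(∫‖g‖⁴))·√(∫‖A‖²)`. [folklore] -/
theorem integral_norm_mul_norm_mul_norm_le {f g : EuclideanSpace ℝ (Fin 3) → EuclideanSpace ℝ (Fin 3)}
    {A : EuclideanSpace ℝ (Fin 3) → (EuclideanSpace ℝ (Fin 3) →L[ℝ] EuclideanSpace ℝ (Fin 3))}
    (hf : Continuous f) (hg : Continuous g) (hA : Continuous A)
    (hf4 : Integrable (fun x => ‖f x‖ ^ 4)) (hg4 : Integrable (fun x => ‖g x‖ ^ 4))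
    (hA2 : Integrable (fun x => ‖A x‖ ^ 2)) :
    Integrable (fun x => ‖f x‖ * ‖g x‖ * ‖A x‖) ∧
      ∫ x, ‖f x‖ * ‖g x‖ * ‖A x‖ ≤
        Real.sqrt (Real.sqrt (∫ x, ‖f x‖ ^ 4) * Real.sqrt (∫ x, ‖g x‖ ^ 4)) * Real.sqrt (∫ x, ‖A x‖ ^ 2) := by
  obtain ⟨hI2, hle2⟩ := integral_sq_mul_sq_le hf.norm hg.norm hf4 hg4
  -- integrability of the triple product: product of two `L²` functions
  have hcfg : Continuous (fun x => ‖f x‖ * ‖g x‖) := hf.norm.mul hg.norm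
  have mfg : MemLp (fun x => ‖f x‖ * ‖g x‖) 2 volume :=
    (memLp_two_iff_integrable_sq_norm hcfg.aestronglyMeasurable).2
      (hI2.congr (ae_of_all _ fun x => by simp only [Real.norm_eq_abs, sq_abs]))
  have hcA : Continuous (fun x => ‖A x‖) := hA.norm
  have mA : MemLp (fun x => ‖A x‖) 2 volume :=
    (memLp_two_iff_integrable_sq_norm hcA.aestronglyMeasurable).2
      (hA2.congr (ae_of_all _ fun x => by simp only [norm_norm]))
  have hI3 : Integrable (fun x => ‖f x‖ * ‖g x‖ * ‖A x‖) := mfg.integrable_mul mA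
  refine ⟨hI3, ?_⟩
  have h := integral_mul_le_sqrt (a := fun x => ‖f x‖ * ‖g x‖) (b := fun x => ‖A x‖) hcfg hcA
    (fun x => mul_nonneg (norm_nonneg _) (norm_nonneg _)) (fun x => norm_nonneg _) hI2 hA2
  refine h.trans (mul_le_mul_of_nonneg_right (Real.sqrt_le_sqrt hle2) (Real.sqrt_nonneg _))

/-- Pointwise: `|⟪f, A g⟫| ≤ ‖f‖·‖g‖·‖A‖`. [folklore] -/
theorem abs_inner_apply_le (f g : EuclideanSpace ℝ (Fin 3)) (A : EuclideanSpace ℝ (Fin 3) →L[ℝ] EuclideanSpace ℝ (Fin 3)) :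
    |⟪f, A g⟫_ℝ| ≤ ‖f‖ * ‖g‖ * ‖A‖ := by
  calc |⟪f, A g⟫_ℝ| ≤ ‖f‖ * ‖A g‖ := abs_real_inner_le_norm _ _
    _ ≤ ‖f‖ * (‖A‖ * ‖g‖) := by gcongr; exact A.le_opNorm g
    _ = ‖f‖ * ‖g‖ * ‖A‖ := by ring

/-! ## §3 The stretching difference `S(v) − S(w)` -/

/-- Pointwise trilinear expansion of the stretching density difference. [folklore] -/
theorem inner_stretch_sub (ω θ : EuclideanSpace ℝ (Fin 3)) (A B : EuclideanSpace ℝ (Fin 3) →L[ℝ] EuclideanSpace ℝ (Fin 3)) :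
    ⟪ω, A ω⟫_ℝ - ⟪θ, B θ⟫_ℝ = ⟪ω - θ, A ω⟫_ℝ + ⟪θ, (A - B) ω⟫_ℝ + ⟪θ, B (ω - θ)⟫_ℝ := by
  have h : (A - B) ω = A ω - B ω := rfl
  rw [h]
  simp only [inner_sub_left, inner_sub_right, map_sub]
  ring

/-- Integrability package of an admissible field (smooth, `D¹, D² ∈ L²`): `‖curl v‖⁴, ‖Dv‖² ∈ L¹` and the stretching density
`⟪curl v, Dv curl v⟫` is integrable. [folklore] -/
theorem stretch_integrable {v : EuclideanSpace ℝ (Fin 3) → EuclideanSpace ℝ (Fin 3)} (hv : ContDiff ℝ (⊤ : ℕ∞) v)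
    (h1 : ∫⁻ x, ‖iteratedFDeriv ℝ 1 v x‖ₑ ^ 2 < ⊤) (h2 : ∫⁻ x, ‖iteratedFDeriv ℝ 2 v x‖ₑ ^ 2 < ⊤) :
    Integrable (fun x => ‖curl v x‖ ^ 4) ∧ Integrable (fun x => ‖fderiv ℝ v x‖ ^ 2) ∧
      Integrable (fun x => ⟪curl v x, fderiv ℝ v x (curl v x)⟫_ℝ) := by
  have hv3 : ContDiff ℝ 3 v := hv.of_le (by norm_cast)
  obtain ⟨_, _, _, _, I4, IDv, _⟩ := slice_integrable hv3 h1 h2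
  have hωc : Continuous (curl v) := (contDiff_curl (n := 1) (hv.of_le (by norm_cast))).continuous
  have hDc : Continuous (fderiv ℝ v) := (hv.of_le (by norm_cast) : ContDiff ℝ 1 v).continuous_fderiv one_ne_zero
  refine ⟨I4, IDv, ?_⟩
  have hI := (integral_norm_mul_norm_mul_norm_le hωc hωc hDc I4 I4 IDv).1
  refine hI.mono' (hωc.inner (hDc.clm_apply hωc)).aestronglyMeasurable (ae_of_all _ fun x => ?_)
  rw [Real.norm_eq_abs]
  exact abs_inner_apply_le _ _ _

/-- **The stretching difference bound.** For admissible `v, w` (smooth, `D¹, D² ∈ L²`), with `ω = curl v`, `θ = curl w`: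
`|S(v) − S(w)| ≤ ‖ω−θ‖₄‖ω‖₄‖Dv‖₂ + ‖θ‖₄‖ω‖₄‖D(v−w)‖₂ + ‖θ‖₄‖ω−θ‖₄‖Dw‖₂`, written with
`‖f‖₄‖g‖₄ = √(√∫‖f‖⁴ · √∫‖g‖⁴)` and `‖A‖₂ = √∫‖A‖²` (operator norms). [folklore] -/
theorem abs_stretching_sub_le {v w : EuclideanSpace ℝ (Fin 3) → EuclideanSpace ℝ (Fin 3)} (hv : ContDiff ℝ (⊤ : ℕ∞) v)
    (hv1 : ∫⁻ x, ‖iteratedFDeriv ℝ 1 v x‖ₑ ^ 2 < ⊤) (hv2 : ∫⁻ x, ‖iteratedFDeriv ℝ 2 v x‖ₑ ^ 2 < ⊤)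
    (hw : ContDiff ℝ (⊤ : ℕ∞) w) (hw1 : ∫⁻ x, ‖iteratedFDeriv ℝ 1 w x‖ₑ ^ 2 < ⊤)
    (hw2 : ∫⁻ x, ‖iteratedFDeriv ℝ 2 w x‖ₑ ^ 2 < ⊤) :
    |(∫ x, ⟪curl v x, fderiv ℝ v x (curl v x)⟫_ℝ) - ∫ x, ⟪curl w x, fderiv ℝ w x (curl w x)⟫_ℝ| ≤
      Real.sqrt (Real.sqrt (∫ x, ‖curl (v - w) x‖ ^ 4) * Real.sqrt (∫ x, ‖curl v x‖ ^ 4)) *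
          Real.sqrt (∫ x, ‖fderiv ℝ v x‖ ^ 2) +
        Real.sqrt (Real.sqrt (∫ x, ‖curl w x‖ ^ 4) * Real.sqrt (∫ x, ‖curl v x‖ ^ 4)) *
          Real.sqrt (∫ x, ‖fderiv ℝ (v - w) x‖ ^ 2) +
        Real.sqrt (Real.sqrt (∫ x, ‖curl w x‖ ^ 4) * Real.sqrt (∫ x, ‖curl (v - w) x‖ ^ 4)) *
          Real.sqrt (∫ x, ‖fderiv ℝ w x‖ ^ 2) := by
  -- the difference field
  have hd : ContDiff ℝ (⊤ : ℕ∞) (v - w) := hv.sub hw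
  have hd1 := lintegral_iteratedFDeriv_sub_lt_top hv hw 1 hv1 hw1
  have hd2 := lintegral_iteratedFDeriv_sub_lt_top hv hw 2 hv2 hw2
  obtain ⟨I4v, IDv, ISv⟩ := stretch_integrable hv hv1 hv2
  obtain ⟨I4w, IDw, ISw⟩ := stretch_integrable hw hw1 hw2
  obtain ⟨I4d, IDd, -⟩ := stretch_integrable hd hd1 hd2
  have hωc : Continuous (curl v) := (contDiff_curl (n := 1) (hv.of_le (by norm_cast))).continuous
  have hθc : Continuous (curl w) := (contDiff_curl (n := 1) (hw.of_le (by norm_cast))).continuous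
  have hδc : Continuous (curl (v - w)) := (contDiff_curl (n := 1) (hd.of_le (by norm_cast))).continuous
  have hDvc : Continuous (fderiv ℝ v) := (hv.of_le (by norm_cast) : ContDiff ℝ 1 v).continuous_fderiv one_ne_zero
  have hDwc : Continuous (fderiv ℝ w) := (hw.of_le (by norm_cast) : ContDiff ℝ 1 w).continuous_fderiv one_ne_zero
  have hDdc : Continuous (fderiv ℝ (v - w)) :=
    (hd.of_le (by norm_cast) : ContDiff ℝ 1 (v - w)).continuous_fderiv one_ne_zero
  -- pointwise identities for the difference
  have hvd : Differentiable ℝ v := hv.differentiable (by simp)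
  have hwd : Differentiable ℝ w := hw.differentiable (by simp)
  have hcurl : ∀ x, curl (v - w) x = curl v x - curl w x := fun x => by rw [curl_sub_eq hvd hwd]
  have hfd : ∀ x, fderiv ℝ (v - w) x = fderiv ℝ v x - fderiv ℝ w x := fun x => fderiv_sub (hvd x) (hwd x)
  -- the three trilinear pieces
  obtain ⟨J1, B1⟩ := integral_norm_mul_norm_mul_norm_le hδc hωc hDvc I4d I4v IDv
  obtain ⟨J2, B2⟩ := integral_norm_mul_norm_mul_norm_le hθc hωc hDdc I4w I4v IDd
  obtain ⟨J3, B3⟩ := integral_norm_mul_norm_mul_norm_le hθc hδc hDwc I4w I4d IDw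
  -- pointwise bound of the density difference
  have hpt : ∀ x, |⟪curl v x, fderiv ℝ v x (curl v x)⟫_ℝ - ⟪curl w x, fderiv ℝ w x (curl w x)⟫_ℝ| ≤
      ‖curl (v - w) x‖ * ‖curl v x‖ * ‖fderiv ℝ v x‖ + ‖curl w x‖ * ‖curl v x‖ * ‖fderiv ℝ (v - w) x‖ +
        ‖curl w x‖ * ‖curl (v - w) x‖ * ‖fderiv ℝ w x‖ := by
    intro x
    rw [inner_stretch_sub, hcurl x, hfd x]
    refine (abs_add_le _ _).trans (add_le_add ((abs_add_le _ _).trans (add_le_add ?_ ?_)) ?_)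
    · exact abs_inner_apply_le _ _ _
    · exact abs_inner_apply_le _ _ _
    · exact abs_inner_apply_le _ _ _
  rw [← integral_sub ISv ISw]
  calc |∫ x, (⟪curl v x, fderiv ℝ v x (curl v x)⟫_ℝ - ⟪curl w x, fderiv ℝ w x (curl w x)⟫_ℝ)|
      ≤ ∫ x, |⟪curl v x, fderiv ℝ v x (curl v x)⟫_ℝ - ⟪curl w x, fderiv ℝ w x (curl w x)⟫_ℝ| :=
        abs_integral_le_integral_abs
    _ ≤ ∫ x, (‖curl (v - w) x‖ * ‖curl v x‖ * ‖fderiv ℝ v x‖ + ‖curl w x‖ * ‖curl v x‖ * ‖fderiv ℝ (v - w) x‖ +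
        ‖curl w x‖ * ‖curl (v - w) x‖ * ‖fderiv ℝ w x‖) :=
        integral_mono_of_nonneg (ae_of_all _ fun x => abs_nonneg _) ((J1.add J2).add J3) (ae_of_all _ hpt)
    _ = (∫ x, ‖curl (v - w) x‖ * ‖curl v x‖ * ‖fderiv ℝ v x‖) +
          (∫ x, ‖curl w x‖ * ‖curl v x‖ * ‖fderiv ℝ (v - w) x‖) +
          ∫ x, ‖curl w x‖ * ‖curl (v - w) x‖ * ‖fderiv ℝ w x‖ := by
        rw [integral_add (f := fun x => ‖curl (v - w) x‖ * ‖curl v x‖ * ‖fderiv ℝ v x‖ +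
            ‖curl w x‖ * ‖curl v x‖ * ‖fderiv ℝ (v - w) x‖)
          (g := fun x => ‖curl w x‖ * ‖curl (v - w) x‖ * ‖fderiv ℝ w x‖) (J1.add J2) J3, integral_add J1 J2]
    _ ≤ _ := add_le_add (add_le_add B1 B2) B3

/-- `‖Dv‖²_{L²} ≤ Z(v)` in operator norm, for admissible (divergence-free) `v`: `‖Dv(x)‖² ≤ |Dv(x)|²_F` and the div–curl
identity `∫|Dv|²_F = ∫|curl v|²`. [folklore] -/
theorem integral_norm_fderiv_sq_le_enstrophy {v : EuclideanSpace ℝ (Fin 3) → EuclideanSpace ℝ (Fin 3)}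
    (hv : ContDiff ℝ (⊤ : ℕ∞) v ∧ VectorCalculus.IsDivFree v ∧ (∫⁻ x, ‖iteratedFDeriv ℝ 0 v x‖ₑ ^ 2 < ⊤) ∧
      (∫⁻ x, ‖iteratedFDeriv ℝ 1 v x‖ₑ ^ 2 < ⊤) ∧ (∫⁻ x, ‖iteratedFDeriv ℝ 2 v x‖ₑ ^ 2 < ⊤)) :
    ∫ x, ‖fderiv ℝ v x‖ ^ 2 ≤ ∫ x, ‖curl v x‖ ^ 2 := by
  obtain ⟨hcd, hdiv, h0, h1, h2⟩ := hv
  have hv3 : ContDiff ℝ 3 v := hcd.of_le (by norm_cast)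
  obtain ⟨_, _, _, _, _, IDv, IFv⟩ := slice_integrable hv3 h1 h2
  have h0' : ∫⁻ x, ‖v x‖ₑ ^ 2 < ⊤ := by
    refine lt_of_le_of_lt (le_of_eq (lintegral_congr fun x => ?_)) h0
    rw [← ofReal_norm, ← norm_iteratedFDeriv_zero (𝕜 := ℝ) (f := v), ofReal_norm]
  rw [← integral_frobeniusNormSq_fderiv_eq_integral_norm_curl_sq (hcd.of_le (by norm_cast)) hdiv h0' h1 h2]
  exact integral_mono IDv IFv fun x => norm_sq_le_frobeniusNormSq _

/-- **Ladyzhenskaya for the vorticity of an admissible field**, raw-integral form: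
`∫‖curl v‖⁴ ≤ K³ · √Z(v) · Pal(v) · √Pal(v)` (`K` = Mathlib's Sobolev constant of `H¹(ℝ³) ⊂ L⁶`).
[cite: Evans2010, §5.6.1 Thm. 1–2] -/
theorem integral_curl_pow_four_le' {v : EuclideanSpace ℝ (Fin 3) → EuclideanSpace ℝ (Fin 3)} (hv : ContDiff ℝ (⊤ : ℕ∞) v)
    (h1 : ∫⁻ x, ‖iteratedFDeriv ℝ 1 v x‖ₑ ^ 2 < ⊤) (h2 : ∫⁻ x, ‖iteratedFDeriv ℝ 2 v x‖ₑ ^ 2 < ⊤) :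
    ∫ x, ‖curl v x‖ ^ 4 ≤ (SNormLESNormFDerivOfEqConst (EuclideanSpace ℝ (Fin 3))
        (volume : Measure (EuclideanSpace ℝ (Fin 3))) 2 : ℝ) ^ 3 * Real.sqrt (∫ x, ‖curl v x‖ ^ 2) *
      ((∫ x, frobeniusNormSq (fderiv ℝ (curl v) x)) * Real.sqrt (∫ x, frobeniusNormSq (fderiv ℝ (curl v) x))) := by
  have h := integral_curl_pow_four_le (hv.of_le (by norm_cast)) h1 h2
  have hP0 : 0 ≤ ∫ x, frobeniusNormSq (fderiv ℝ (curl v) x) := integral_nonneg fun x => frobeniusNormSq_nonneg _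
  have e : (Literature.Claims.NS.Magsanop2026.gradSq (curl v)) ^ (3 / 2 : ℝ) =
      (∫ x, frobeniusNormSq (fderiv ℝ (curl v) x)) * Real.sqrt (∫ x, frobeniusNormSq (fderiv ℝ (curl v) x)) := by
    show (∫ x, frobeniusNormSq (fderiv ℝ (curl v) x)) ^ (3 / 2 : ℝ) = _
    rw [show (3 / 2 : ℝ) = 1 + 1 / 2 by norm_num, Real.rpow_add' hP0 (by norm_num), Real.rpow_one, Real.sqrt_eq_rpow]
  rw [e] at h
  exact h

end SeqCore

end NearSaturationNearMaximiser

end Summit.NavierStokesRegularity.NavierStokesRegularity.Theorems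

end
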